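import Literature.NumberTheory.Automorphic.TwistedQuotientLevelProdSemilinear
import Literature.NumberTheory.Automorphic.TwistedQuotientRestrictScalars
import HarnessLib

/-!
# Descent of annihilators along a finite free extension of the coefficient ring for `H^q(Γ, W^{L/L'})`

Topic `NumberTheory/Automorphic`; namespace `Literature.NumberTheory.Automorphic.TwistedQuotient`
(and two generic lemmas on `Literature.Algebra.Homology.semimap`).  Theorems only; no definition,
no named fact, no instance, no `sorry`.

Setting of `TwistedQuotientLevelProdSemilinear`: `W = Fun(𝒢 ⧸ L', N₀)` over `k₀`,
`W₁ = Fun(𝒢 ⧸ L', N₁)` over a `k₀`-algebra `k₁`, and an equivariant `e : N₀ →ₛₗ N₁` (think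
`N₁ = k₁ ⊗_{k₀} N₀`, `e v = 1 ⊗ v`).  If `k₀`-linear equivariant "coordinate" maps `π_m : N₁ → N₀`
satisfy `π_m (a • e v) = a_m • v` (the coordinates of `a ∈ k₁` in a `k₀`-basis), then
**`a • Hⁿ(e) x = 0` implies `a_m • x = 0` for every `m`**
(`smul_eq_zero_of_smul_semimap_eq_zero`): the annihilator of the base-changed class is generated by
the annihilator of the class.  Ingredients: `Hⁿ` of the identity `N₁|_{k₀} → N₁` is injective
(bijective), multiplication by `a` on `N₁` is `k₀`-linear and equivariant, and `Hⁿ` is functorial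
(`semimap_semimap`) and compatible with scalars (`semimap_eq_smul_semimap`).

Use: the step "`a c = 0` in `H^q` over `𝒪_{E'}` forces `a ∈ p^{t'-m₀} 𝒪_{E'}`" of the passage from
`𝒪_{E₀}` to `ℤ̄_p = ⋃ 𝒪_{E'}` in [Scholze2015, §V.4] (`𝒪_{E'}` finite free over `𝒪_{E₀}`).

## References

* K. S. Brown, *Cohomology of Groups*, GTM 87 (1982), III.1 Example 3. [Brown1982CohomologyGroups]
* P. Scholze, Ann. of Math. 182 (2015), §V.4. [Scholze2015]
-/

noncomputable section

open CategoryTheory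

universe u

/-! ### Two generic lemmas on `semimap` -/

namespace Literature.Algebra.Homology

open groupCohomology

variable {k k' : Type u} [CommRing k] [CommRing k'] {G : Type u} [Group G] {σ : k →+* k'}
  {A : Rep k G} {B : Rep k' G}

/-- **`Hⁿ(a • s) = a • Hⁿ(s)`**: if `s' = a • s` pointwise then `Hⁿ(s') x = a • Hⁿ(s) x`. [folklore] -/
theorem semimap_eq_smul_semimap (s : A.V →ₛₗ[σ] B.V)
    (hs : ∀ (g : G) (v : A.V), s (A.ρ g v) = B.ρ g (s v)) (a : k') (s' : A.V →ₛₗ[σ] B.V)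
    (hs' : ∀ (g : G) (v : A.V), s' (A.ρ g v) = B.ρ g (s' v)) (h : ∀ v, s' v = a • s v) (n : ℕ)
    (x : groupCohomology A n) : semimap s' hs' n x = a • semimap s hs n x := by
  induction x using groupCohomology_induction_on with
  | h z =>
    rw [semimap_π, semimap_π]
    have hsm : ∀ w : cocycles B n, a • (groupCohomology.π B n) w = (groupCohomology.π B n) (a • w) :=
      fun w => (map_smul (groupCohomology.π B n).hom a w).symm
    rw [hsm]
    congr 1
    refine iCocycles_injective B n ?_
    rw [iCocycles_cocyclesSemimap, map_smul, iCocycles_cocyclesSemimap]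
    funext g
    rw [cochainsSemimap_apply, Pi.smul_apply, cochainsSemimap_apply, h]

/-- `Hⁿ` of the zero map is zero. [folklore] -/
theorem semimap_eq_zero_of_eq_zero (s : A.V →ₛₗ[σ] B.V)
    (hs : ∀ (g : G) (v : A.V), s (A.ρ g v) = B.ρ g (s v)) (h : ∀ v, s v = 0) (n : ℕ)
    (x : groupCohomology A n) : semimap s hs n x = 0 := by
  rw [semimap_eq_smul_semimap s hs 0 s hs (fun v => by rw [h, zero_smul]) n x, zero_smul]

end Literature.Algebra.Homology

namespace Literature.NumberTheory.Automorphic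

namespace TwistedQuotient

open Literature.Algebra.Homology

variable {k₀ k₁ : Type u} [CommRing k₀] [CommRing k₁] [Algebra k₀ k₁] {Γ 𝒢 : Type u} [Group Γ]
  [Group 𝒢] (ι : Γ →* 𝒢) {L' L : Subgroup 𝒢} (hle : L' ≤ L) [hN : (L'.subgroupOf L).Normal]
  {N₀ : Type u} [AddCommGroup N₀] [Module k₀ N₀] {N₁ : Type u} [AddCommGroup N₁] [Module k₁ N₁]
  [Module k₀ N₁] [IsScalarTower k₀ k₁ N₁]
  (σ₀ : Representation k₀ (L ⧸ L'.subgroupOf L) N₀) (σ₁ : Representation k₁ (L ⧸ L'.subgroupOf L) N₁)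
  (e : N₀ →ₛₗ[algebraMap k₀ k₁] N₁)
  (he : ∀ (h : L ⧸ L'.subgroupOf L) (v : N₀), e (σ₀ h v) = σ₁ h (e v))

/-- Multiplication by `a ∈ k₁` on `N₁` as a `k₀`-linear map, equivariant for `resScalars k₀ σ₁`.
[folklore] -/
theorem smul_equivariant (a : k₁) (h : L ⧸ L'.subgroupOf L) (w : N₁) :
    (a • (LinearMap.id : N₁ →ₗ[k₀] N₁)) (resScalars k₀ σ₁ h w) =
      resScalars k₀ σ₁ h ((a • (LinearMap.id : N₁ →ₗ[k₀] N₁)) w) := by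
  simp only [LinearMap.smul_apply, LinearMap.id_apply, resScalars_apply, map_smul]

include he in
/-- **Descent of annihilators.**  If `k₀`-linear equivariant maps `π_m : N₁ → N₀` satisfy
`π_m (a • e v) = a_m • v`, then `a • Hⁿ(e) x = 0` implies `a_m • x = 0` for all `m`.
[cite: Scholze2015, §V.4 (proof of Thm. V.4.1)] [cite: Brown1982CohomologyGroups, III.1 Example 3] -/
theorem smul_eq_zero_of_smul_semimap_eq_zero {M : Type*} (π : M → (N₁ →ₗ[k₀] N₀))
    (hπ : ∀ (m : M) (h : L ⧸ L'.subgroupOf L) (w : N₁), π m (σ₁ h w) = σ₀ h (π m w))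
    (a : k₁) (coeff : M → k₀) (hcoord : ∀ (m : M) (v : N₀), π m (a • e v) = coeff m • v)
    (q : ℕ) (x : groupCohomology (hKerRep (oneProdTwist ι hle σ₀) 0) q)
    (hax : a • semimap (hKerSemimap ι hle σ₀ σ₁ e he) (hKerSemimap_equivariant ι hle σ₀ σ₁ e he) q x = 0)
    (m : M) : coeff m • x = 0 := by
  -- the identity `N₁|_{k₀} → N₁` and `e` as a `k₀`-linear map
  let j : N₁ →ₛₗ[algebraMap k₀ k₁] N₁ :=
    { toFun := id, map_add' := fun _ _ => rfl, map_smul' := fun c w => (algebraMap_smul k₁ c w).symm }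
  have hj : ∀ (h : L ⧸ L'.subgroupOf L) (w : N₁), j (resScalars k₀ σ₁ h w) = σ₁ h (j w) := fun _ _ => rfl
  let e₀ : N₀ →ₗ[k₀] N₁ :=
    { toFun := e, map_add' := map_add e,
      map_smul' := fun c v => by rw [map_smulₛₗ e, RingHom.id_apply, algebraMap_smul] }
  have he₀ : ∀ (h : L ⧸ L'.subgroupOf L) (v : N₀), e₀ (σ₀ h v) = resScalars k₀ σ₁ h (e₀ v) :=
    fun h v => by change e (σ₀ h v) = σ₁ h (e v); exact he h v
  -- multiplication by `a` over `k₀`, and the coordinate maps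
  let μ : N₁ →ₗ[k₀] N₁ := a • LinearMap.id
  have hμ : ∀ (h : L ⧸ L'.subgroupOf L) (w : N₁), μ (resScalars k₀ σ₁ h w) = resScalars k₀ σ₁ h (μ w) :=
    smul_equivariant σ₁ a
  have hπ' : ∀ (h : L ⧸ L'.subgroupOf L) (w : N₁), π m (resScalars k₀ σ₁ h w) = σ₀ h (π m w) :=
    fun h w => by rw [resScalars_apply]; exact hπ m h w
  -- the comparison maps on `W^{L/L'}`
  let sj := hKerSemimap ι hle (resScalars k₀ σ₁) σ₁ j hj
  let se := hKerSemimap ι hle σ₀ (resScalars k₀ σ₁) e₀ he₀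
  let sμ := hKerSemimap ι hle (resScalars k₀ σ₁) (resScalars k₀ σ₁) μ hμ
  let sπ := hKerSemimap ι hle (resScalars k₀ σ₁) σ₀ (π m) hπ'
  have Hj := hKerSemimap_equivariant ι hle (resScalars k₀ σ₁) σ₁ j hj
  have He := hKerSemimap_equivariant ι hle σ₀ (resScalars k₀ σ₁) e₀ he₀
  have Hμ := hKerSemimap_equivariant ι hle (resScalars k₀ σ₁) (resScalars k₀ σ₁) μ hμ
  have Hπ := hKerSemimap_equivariant ι hle (resScalars k₀ σ₁) σ₀ (π m) hπ'
  -- (1) `Hⁿ(e) = Hⁿ(j) ∘ Hⁿ(e₀)`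
  have h1 : semimap (hKerSemimap ι hle σ₀ σ₁ e he) (hKerSemimap_equivariant ι hle σ₀ σ₁ e he) q x =
      semimap sj Hj q (semimap se He q x) :=
    (semimap_semimap se He sj Hj _ (hKerSemimap_equivariant ι hle σ₀ σ₁ e he)
      (fun f => Subtype.ext (funext fun y => funext fun c => rfl)) q x).symm
  -- (2) `a • Hⁿ(j) y = Hⁿ(j) (Hⁿ(μ) y)`: both are `Hⁿ` of the values map `w ↦ a • w`
  let sa : hKerRep (oneProdTwist ι hle (resScalars k₀ σ₁)) 0 →ₛₗ[algebraMap k₀ k₁]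
      hKerRep (oneProdTwist ι hle σ₁) 0 :=
    hKerSemimap ι hle (resScalars k₀ σ₁) σ₁ (j.comp μ) (fun h w => by
      rw [LinearMap.comp_apply, hμ]; rfl)
  have Ha : ∀ (γ : Γ) (f : (hKerRep (oneProdTwist ι hle (resScalars k₀ σ₁)) 0).V),
      sa ((hKerRep (oneProdTwist ι hle (resScalars k₀ σ₁)) 0).ρ γ f) =
        (hKerRep (oneProdTwist ι hle σ₁) 0).ρ γ (sa f) :=
    hKerSemimap_equivariant ι hle (resScalars k₀ σ₁) σ₁ _ _
  have h2 : ∀ y, semimap sj Hj q (semimap sμ Hμ q y) = a • semimap sj Hj q y := by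
    intro y
    rw [semimap_semimap sμ Hμ sj Hj sa Ha (fun f => Subtype.ext (funext fun z => funext fun c => rfl)) q y]
    exact semimap_eq_smul_semimap sj Hj a sa Ha
      (fun f => Subtype.ext (funext fun z => funext fun c => rfl)) q y
  -- (3) hence `Hⁿ(μ) (Hⁿ(e₀) x) = 0` by injectivity of `Hⁿ(j)`
  have hinj : Function.Injective (semimap sj Hj q) :=
    semimap_injective_of_bijective sj Hj
      (hKerSemimap_bijective ι hle (resScalars k₀ σ₁) σ₁ j hj Function.bijective_id) q
  have h3 : semimap sμ Hμ q (semimap se He q x) = 0 := by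
    apply hinj
    rw [h2, ← h1, hax, map_zero]
  -- (4) apply `Hⁿ(π_m)`: the composite values map is `v ↦ π_m (a • e v) = a_m • v`
  let sid : hKerRep (oneProdTwist ι hle σ₀) 0 →ₗ[k₀] hKerRep (oneProdTwist ι hle σ₀) 0 :=
    hKerSemimap ι hle σ₀ σ₀ (LinearMap.id : N₀ →ₗ[k₀] N₀) (fun _ _ => rfl)
  have Hid := hKerSemimap_equivariant ι hle σ₀ σ₀ (LinearMap.id : N₀ →ₗ[k₀] N₀) (fun _ _ => rfl)
  let sc : hKerRep (oneProdTwist ι hle σ₀) 0 →ₗ[k₀] hKerRep (oneProdTwist ι hle σ₀) 0 :=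
    hKerSemimap ι hle σ₀ σ₀ ((π m).comp (μ.comp e₀)) (fun h v => by
      simp only [LinearMap.comp_apply]
      rw [he₀, hμ, hπ'])
  have Hc := hKerSemimap_equivariant ι hle σ₀ σ₀ ((π m).comp (μ.comp e₀)) (fun h v => by
      simp only [LinearMap.comp_apply]
      rw [he₀, hμ, hπ'])
  have h4 : semimap sπ Hπ q (semimap sμ Hμ q (semimap se He q x)) = coeff m • x := by
    rw [semimap_semimap se He sμ Hμ (hKerSemimap ι hle σ₀ (resScalars k₀ σ₁) (μ.comp e₀)
        (fun h v => by simp only [LinearMap.comp_apply]; rw [he₀, hμ]))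
        (hKerSemimap_equivariant ι hle σ₀ (resScalars k₀ σ₁) (μ.comp e₀) _)
        (fun f => Subtype.ext (funext fun z => funext fun c => rfl)) q x,
      semimap_semimap _ _ sπ Hπ sc Hc (fun f => Subtype.ext (funext fun z => funext fun c => rfl)) q x,
      semimap_eq_smul_semimap sid Hid (coeff m) sc Hc (fun f => Subtype.ext (funext fun z =>
        funext fun c => by
          rw [val_hKerSemimap]
          change π m (a • e (f.1 z c)) = (coeff m • sid f).1 z c
          rw [hcoord]
          rfl)) q x,
      semimap_eq_self sid Hid (fun f => Subtype.ext (funext fun z => funext fun c => rfl)) q x]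
  rw [← h4, h3, map_zero]

end TwistedQuotient

end Literature.NumberTheory.Automorphic
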